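import Mathlib
import HarnessLib
import Summits.HubbardSuperconductivity.HubbardSuperconductivity.Theorems.KLProgrammeKLRegimeAlphaWtSectionalRegime
import Summits.HubbardSuperconductivity.HubbardSuperconductivity.Theorems.KLProgrammeKLRegimeAlphaWtFlowDeep
import Summits.HubbardSuperconductivity.HubbardSuperconductivity.Theorems.KLProgrammeKLRegimeTwoVolumeSpineDataDefs

/-!
# K3 VL child `KLRegimeVolumeLimitV17F2` (stmt-HubbardSuperconductivity-20440), blueprint v5 M3b-j (ii): **the SECTIONAL Λ-scaled row `eW′` AT THE
# FLOW FRAME, DEEP WINDOW** — `Σ_y ‖(S(F̃_nf)ᵀ·klSliceCov (nf+j)·S(F̃_nf))(X, ((t,y),ℓ))‖·(1 + Λ_w·tnorm(x⃗ − y)) ≤ Ce` at `K_n`, every rate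
# `0 ≤ Λ_w ≤ Λ_{nf+j}`, under the binders of `E4FlowAt` / `stub_engine_step_norms` on the U-DEPENDENT window `4^{n+2}·U ≤ 4^{2·nf+d}` — ONE constant per `(j, d)`

Cell `gate-hubbard-kl`, seat p3 (g12).  The sectional twin of `…AlphaWtFlowDeep.alphaWt_klSliceCov_bgmFat_klEng_flow_deep (j d)` (p3 g11): the SAME
history data — `‖D³(frameShift K_n)‖ ≤ Gfr₃U²4ⁿ/3` (`frameShift_high_sizes_of_frameOK` on `frameOK_klFlowFrameU_succ`) and
`‖D³e_{K_n}‖ ≤ 64 + Gfr₃U²·Σ_{m<n}4^m` (`norm_iteratedFDeriv_frameLevel_klFlowFrameU_le`) — give `A₃Λ_{nf−1}² ≤ 4^d/3072` and `K₃Λ_{nf+j}² ≤ 1/16 + 4^d/3072`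
on the deep window through `Gfr₃·U ≤ 1` (`frameDatum_le_of_pow_window`); they are packaged once as `klFlowFrameU_thirdOrder_data`, and fed to
`…AlphaWtSectionalRegime.secWt_klSliceCov_bgmFat_of_thresholds`.

* `klFlowFrameU_thirdOrder_data` — the order-three frame data of `K_n` with their deep-window datum inequalities (one `∃ A₃ K₃`);
* **`secWt_klSliceCov_bgmFat_klEng_flow_deep (j d)`** — `∃ Ce > 0`: for every `G P R Q cc` (`R.WF2`, `0 < cc ≤ klEngC₃6 P R`), `μ ∈ klWindowC`,
  `0 < U ≤ min (klEngU₀3 P R cc) (1/(Gfr₃+1))`, `klBetaMin ≤ β ≤ e^{cc/U²}`, `klEngL₃ β U ≤ L`, `klEngM₃ β U L ≤ M`, `1 ≤ n ≤ n_β + 1`,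
  `HistP klPredsV17F2 … 0 n`, `FrameOK R U n_β μ K_n`, every `1 ≤ nf` with `nf + j ≤ n_β + 1`, `4^{n+2}·U ≤ 4^{2·nf+d}`, every `0 ≤ Λ_w ≤ Λ_{nf+j}`, every
  `X`, `t`, `ℓ`: the sectional Λ_w-scaled row is `≤ Ce` — this IS `hsecW'` of `…TwoVolumeSrcSectorScaleSuccMinS` / `ScaleCovSecData.sec` of
  `…TwoVolumeSpineDataDefs` for the fine sector covariance `S(F̃_nf)ᵀ·klSliceCov (nf+j)·S(F̃_nf)` at the flow frame (ε-free, Λ-free, L-free);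
* **`secWt_klSliceCov_bgmFat_klEng_flow_deep_at (j d)`** — the same bound at ANY EARLIER flow frame `K_m`, `1 ≤ m ≤ n`, from the CURRENT history alone
  (`histP_klPredsV17F2_restrict` + `frameOK_klFlowFrameU_of_histP_le`);
* **`scaleCovSecData_klSliceCov_bgmFat_klEng_flow_deep (j d)`** — the same, BUNDLED as k3c4-p1's `TwoVolumeDefect.ScaleCovSecData C Λ_w Ce` (M3b-j (ii)
  BY NAME for the fine sector covariance at the flow frame).

Everything is proved; no definitions. [cite: BenfattoGiulianiMastropietro2006, §2.8 (2.81), §3 (3.3)]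
-/

noncomputable section

namespace Summit.HubbardSuperconductivity.HubbardSuperconductivity.Theorems.TorusFourierL2

set_option linter.dupNamespace false -- summit = problem name (single-conjunct summit), D-0017

open Set Finset Literature.MathematicalPhysics.QuantumLattice Literature.MathematicalPhysics.QuantumLattice.BandSectorCounting
open Literature.MathematicalPhysics.QuantumLattice.FermiRG Literature.Probability.LatticeModels Literature.Analysis.SpecialFunctions
open Summit.HubbardSuperconductivity.HubbardSuperconductivity.Theorems.DispersionFlow
open Summit.HubbardSuperconductivity.HubbardSuperconductivity.Theorems.KLRegimeSplit
open Summit.HubbardSuperconductivity.HubbardSuperconductivity.Theorems.KLProgrammeLegKernels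
open Summit.HubbardSuperconductivity.HubbardSuperconductivity.Theorems.PerturbedFermiCurve
open Summit.HubbardSuperconductivity.HubbardSuperconductivity.Theorems.KLRegimeWick
open Summit.HubbardSuperconductivity.HubbardSuperconductivity.Theorems.EngineV8
open scoped Real Nat

open Classical

/-- **The order-three data of the flow frame `K_n` with their deep-window datum inequalities** (`n ≥ 1`; `R.WF2`, `U ≤ 1/(Gfr₃+1)`,
`HistP klPredsV17F2 … 0 n`, `1 ≤ nf`, `4^{n+2}·U ≤ 4^{2·nf+d}`): there are `A₃, K₃` with `‖D³(frameShift K_n)‖ ≤ A₃`, `‖D³e_{K_n}‖ ≤ K₃`,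
`A₃Λ_{nf−1}² ≤ 4^d/3072` and `K₃Λ_{nf+j}² ≤ 1/16 + 4^d/3072` (the inline data of `alphaWt_klSliceCov_bgmFat_klEng_flow_deep`, packaged).
[cite: BenfattoGiulianiMastropietro2006, §3 (3.3)] -/
theorem klFlowFrameU_thirdOrder_data {L M : ℕ} [NeZero L] [NeZero M] {G : GeoConsts} {P : SplitConsts} {Q : EngConsts} {R : RenConsts}
    {β U μ : ℝ} (hR2 : R.WF2) (hU : 0 < U) (hUG : U ≤ 1 / (R.Gfr 3 + 1)) {n : ℕ} (hn1 : 1 ≤ n)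
    (hhist : HistP klPredsV17F2 L M G P Q R β U μ 0 n) {nf j dd : ℕ} (hnf : 1 ≤ nf) (hwin : (4 : ℝ) ^ (n + 2) * U ≤ (4 : ℝ) ^ (2 * nf + dd)) :
    ∃ A₃ K₃ : ℝ, (∀ p : Momentum, ‖iteratedFDeriv ℝ 3 (frameShift (klFlowFrameU L M β U μ n)) p‖ ≤ A₃) ∧
      (∀ p : Momentum, ‖iteratedFDeriv ℝ 3 (frameLevel μ (klFlowFrameU L M β U μ n)) p‖ ≤ K₃) ∧
      A₃ * klScale klE0 (nf - 1) ^ 2 ≤ (4 : ℝ) ^ dd / 3072 ∧ K₃ * klScale klE0 (nf + j) ^ 2 ≤ 1 / 16 + (4 : ℝ) ^ dd / 3072 := by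
  have hRj : ∀ i, 0 ≤ R.Gfr i := EngineV8.gfr_nonneg_of_wf2 hR2
  set K : TrigPolyC4v := klFlowFrameU L M β U μ n with hKdef
  obtain ⟨N, rfl⟩ : ∃ N, n = N + 1 := ⟨n - 1, by omega⟩
  have hh := (histP_klPredsV17F2_iff L M G P Q R β U μ 0 (N + 1)).1 hhist
  have hJets : ∀ m ≤ N, FlowPieceJetsAt L M β U μ R m := fun m hm => (hh m (Nat.lt_succ_of_le hm)).2.1.2.1
  have hJets' : ∀ m < N + 1, FlowPieceJetsAt L M β U μ R m := fun m hm => hJets m (Nat.le_of_lt_succ hm)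
  have hGeo : FlowGeometryAt L M β U μ N := (hh N (Nat.lt_succ_self N)).2.1.2.2
  have hK1 : FrameOK R U N μ K := frameOK_klFlowFrameU_succ hJets hGeo
  have hA3 : ∀ p : Momentum, ‖iteratedFDeriv ℝ 3 (frameShift K) p‖ ≤ R.Gfr 3 * U ^ 2 * ((4 : ℝ) ^ (N + 1) / 3) :=
    (frameShift_high_sizes_of_frameOK hRj hK1).1
  -- the door `U ≤ 1/(Gfr₃+1)` gives `Gfr₃·U ≤ 1`
  have hGU : R.Gfr 3 * U ≤ 1 := by
    have hG3 := hRj 3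
    calc R.Gfr 3 * U ≤ R.Gfr 3 * (1 / (R.Gfr 3 + 1)) := mul_le_mul_of_nonneg_left hUG hG3
      _ = R.Gfr 3 / (R.Gfr 3 + 1) := by ring
      _ ≤ 1 := by rw [div_le_one (by positivity)]; linarith only [hG3]
  -- the geometric sum of the band third-derivative bound
  have hsum : ∑ m' ∈ range (N + 1), R.Gfr 3 * uPow 3 U * (4 : ℝ) ^ ((((3 : ℕ) : ℤ) - 2) * m') ≤ R.Gfr 3 * U ^ 2 * ((4 : ℝ) ^ (N + 1) / 3) := by
    have e3 : uPow 3 U = U ^ 2 := by rw [show (3 : ℕ) = 2 + 1 by rfl, uPow_succ]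
    have hterm : ∀ m' : ℕ, (4 : ℝ) ^ ((((3 : ℕ) : ℤ) - 2) * (m' : ℤ)) = (4 : ℝ) ^ m' := by
      intro m'
      rw [show (((3 : ℕ) : ℤ) - 2) * (m' : ℤ) = ((m' : ℕ) : ℤ) by push_cast; ring, zpow_natCast]
    have hgeom : ∀ k : ℕ, ∑ m' ∈ range k, (4 : ℝ) ^ m' ≤ (4 : ℝ) ^ k / 3 := by
      intro k
      induction k with
      | zero => simp
      | succ k ih => rw [Finset.sum_range_succ, pow_succ]; linarith
    calc ∑ m' ∈ range (N + 1), R.Gfr 3 * uPow 3 U * (4 : ℝ) ^ ((((3 : ℕ) : ℤ) - 2) * m')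
        = R.Gfr 3 * U ^ 2 * ∑ m' ∈ range (N + 1), (4 : ℝ) ^ m' := by
          rw [Finset.mul_sum]; exact Finset.sum_congr rfl fun m' _ => by rw [e3, hterm]
      _ ≤ R.Gfr 3 * U ^ 2 * ((4 : ℝ) ^ (N + 1) / 3) := mul_le_mul_of_nonneg_left (hgeom (N + 1)) (by have := hRj 3; positivity)
  have hK3 : ∀ p : Momentum, ‖iteratedFDeriv ℝ 3 (frameLevel μ K) p‖ ≤ 64 + R.Gfr 3 * U ^ 2 * ((4 : ℝ) ^ (N + 1) / 3) := by
    intro p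
    have h0 := norm_iteratedFDeriv_frameLevel_klFlowFrameU_le (L := L) (M := M) (β := β) (U := U) (μ := μ) (i := 3) (by norm_num) (by norm_num)
      hJets' p
    have e64 : (4 : ℝ) ^ (3 : ℕ) = 64 := by norm_num
    rw [e64] at h0
    exact h0.trans (by linarith only [hsum])
  -- the data on the DEEP window `4^{n+2}·U ≤ 4^{2·nf+dd}`
  have hdatA : R.Gfr 3 * U ^ 2 * ((4 : ℝ) ^ (N + 1) / 3) * klScale klE0 (nf - 1) ^ 2 ≤ (4 : ℝ) ^ dd / 3072 :=
    frameDatum_le_of_pow_window hU.le hGU hnf hwin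
  have hdatK : (64 + R.Gfr 3 * U ^ 2 * ((4 : ℝ) ^ (N + 1) / 3)) * klScale klE0 (nf + j) ^ 2 ≤ 1 / 16 + (4 : ℝ) ^ dd / 3072 := by
    have hΛle : klScale klE0 (nf + j) ≤ klScale klE0 (nf - 1) := EngineV8.klScale_le_klScale (by norm_num [klE0]) (by omega)
    have hΛe : klScale klE0 (nf + j) ≤ 1 / 32 := by
      have := klScale_le_e0 (show (0 : ℝ) ≤ klE0 by norm_num [klE0]) (nf + j); rwa [show klE0 = 1 / 32 from rfl] at this
    have hΛ0 : 0 ≤ klScale klE0 (nf + j) := (klth_klScale_pos _).le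
    have h1 : 64 * klScale klE0 (nf + j) ^ 2 ≤ 1 / 16 := by nlinarith [hΛe, hΛ0]
    have h2 : R.Gfr 3 * U ^ 2 * ((4 : ℝ) ^ (N + 1) / 3) * klScale klE0 (nf + j) ^ 2 ≤ (4 : ℝ) ^ dd / 3072 := by
      refine le_trans ?_ hdatA
      have h0 : 0 ≤ R.Gfr 3 * U ^ 2 * ((4 : ℝ) ^ (N + 1) / 3) := by have := hRj 3; positivity
      exact mul_le_mul_of_nonneg_left (pow_le_pow_left₀ hΛ0 hΛle 2) h0
    nlinarith only [h1, h2]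
  exact ⟨_, _, hA3, hK3, hdatA, hdatK⟩

set_option maxHeartbeats 800000 in -- long binder list
/-- **The SECTIONAL Λ-scaled row at the flow frame, in the KL regime, DEEP WINDOW `4^{n+2}·U ≤ 4^{2·nf+d}`** (see the module docstring): the
`hsecW'` datum of the blueprint-v5 two-volume step for `S(F̃_nf)ᵀ·klSliceCov (nf+j)·S(F̃_nf)` at `K_n`, every rate `0 ≤ Λ_w ≤ Λ_{nf+j}`; one constant
per `(j, d)`, `R`-free, `U`-free, ε-free. [cite: BenfattoGiulianiMastropietro2006, §2.8 (2.81), §3 (3.3)] -/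
theorem secWt_klSliceCov_bgmFat_klEng_flow_deep (j dd : ℕ) :
    ∃ Ce : ℝ, 0 < Ce ∧
      ∀ (G : GeoConsts) (P : SplitConsts) (R : RenConsts) (Q : EngConsts) (cc : ℝ), R.WF2 → 0 < cc → cc ≤ EngineV8.klEngC₃6 P R →
      ∀ μ ∈ klWindowC, ∀ U : ℝ, 0 < U → U ≤ min (EngineV8.klEngU₀3 P R cc) (1 / (R.Gfr 3 + 1)) →
      ∀ β : ℝ, klBetaMin ≤ β → β ≤ Real.exp (cc / U ^ 2) →
      ∀ (L M : ℕ) [NeZero L] [NeZero M], EngineV8.klEngL₃ β U ≤ L → EngineV8.klEngM₃ β U L ≤ M →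
      ∀ n : ℕ, 1 ≤ n → n ≤ nScales β + 1 →
        HistP klPredsV17F2 L M G P Q R β U μ 0 n → FrameOK R U (nScales β) μ (klFlowFrameU L M β U μ n) →
        ∀ nf : ℕ, 1 ≤ nf → nf + j ≤ nScales β + 1 → (4 : ℝ) ^ (n + 2) * U ≤ (4 : ℝ) ^ (2 * nf + dd) →
        ∀ Λw : ℝ, 0 ≤ Λw → Λw ≤ klScale klE0 (nf + j) →
        ∀ (X : SpaceTimeIdx L M × SectorLeg (sectorCount nf)) (t : ImagTimeIdx M) (ℓ : SectorLeg (sectorCount nf)),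
          ∑ y : TorusSite 2 L, ‖((sectorSubMatrix L M β (bgmFatMultiplier L M klE0 β (nambuXiCT L μ (klFlowFrameU L M β U μ n)) nf)).transpose *
            klSliceCov L M β μ (klFlowFrameU L M β U μ n) (nf + j) *
            sectorSubMatrix L M β (bgmFatMultiplier L M klE0 β (nambuXiCT L μ (klFlowFrameU L M β U μ n)) nf)) X ((t, y), ℓ)‖ *
              (1 + Λw * (Torus.tnorm (X.1.2 - y) : ℝ)) ≤ Ce := by
  have ha : (-4 : ℝ) < -(6 / 5) := by norm_num
  have hab : (-(6 / 5) : ℝ) ≤ -(1 / 10) := by norm_num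
  have hb : (-(1 / 10) : ℝ) < 0 := by norm_num
  obtain ⟨Ce, hCe, h⟩ := secWt_klSliceCov_bgmFat_of_thresholds ha hab hb j ((4 : ℝ) ^ dd / 3072) (1 / 16 + (4 : ℝ) ^ dd / 3072)
  refine ⟨Ce, hCe, ?_⟩
  intro G P R Q cc hR2 hcc hcc6 μ hμ U hU hUle β hβmin hβc L M _ _ hL3 hM3 n hn1 hnN hhist hfr nf hnf hnfN hwin Λw hΛw0 hΛwle X t ℓ
  have hRj : ∀ i, 0 ≤ R.Gfr i := EngineV8.gfr_nonneg_of_wf2 hR2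
  have hcle := (hcc6.trans (EngineV8.klEngC₃6_le_klEngC₃3 P R)).trans (EngineV8.klEngC₃3_le_symbolC₃ ha hab hb P hRj)
  have hU3 := (hUle.trans (min_le_left _ _)).trans (EngineV8.klEngU₀3_le_symbolU₀ ha hab hb P hRj cc)
  have hUG : U ≤ 1 / (R.Gfr 3 + 1) := hUle.trans (min_le_right _ _)
  have hLβ : β ^ 2 ≤ (L : ℝ) := EngineV8.sq_le_of_klEngL₃_le hL3
  have hMβ : β ≤ (M : ℝ) := EngineV8.le_of_klEngM₃_le hβmin hL3 hM3
  obtain ⟨A₃, K₃, hA3, hK3, hdatA, hdatK⟩ := klFlowFrameU_thirdOrder_data (j := j) hR2 hU hUG hn1 hhist hnf hwin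
  exact h R hRj cc U hcc hcle hU hU3 β hβmin hβc μ hμ _ hfr A₃ K₃ hA3 hK3 L M hLβ hMβ nf hnf hnfN hdatA hdatK Λw hΛw0 hΛwle X t ℓ

/-- **The SECTIONAL Λ-scaled row at ANY EARLIER flow frame `K_m` (`1 ≤ m ≤ n`) from the CURRENT history, deep window at `m`** —
`secWt_klSliceCov_bgmFat_klEng_flow_deep` at `n := m` with its two frame inputs discharged by `histP_klPredsV17F2_restrict` and
`frameOK_klFlowFrameU_of_histP_le`.  Same constant `Ce(j, d)`. [cite: BenfattoGiulianiMastropietro2006, §2.8 (2.81), §3 (3.3)] -/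
theorem secWt_klSliceCov_bgmFat_klEng_flow_deep_at (j dd : ℕ) :
    ∃ Ce : ℝ, 0 < Ce ∧
      ∀ (G : GeoConsts) (P : SplitConsts) (R : RenConsts) (Q : EngConsts) (cc : ℝ), R.WF2 → 0 < cc → cc ≤ EngineV8.klEngC₃6 P R →
      ∀ μ ∈ klWindowC, ∀ U : ℝ, 0 < U → U ≤ min (EngineV8.klEngU₀3 P R cc) (1 / (R.Gfr 3 + 1)) →
      ∀ β : ℝ, klBetaMin ≤ β → β ≤ Real.exp (cc / U ^ 2) →
      ∀ (L M : ℕ) [NeZero L] [NeZero M], EngineV8.klEngL₃ β U ≤ L → EngineV8.klEngM₃ β U L ≤ M →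
      ∀ n : ℕ, n ≤ nScales β + 1 → HistP klPredsV17F2 L M G P Q R β U μ 0 n →
        ∀ m : ℕ, 1 ≤ m → m ≤ n →
        ∀ nf : ℕ, 1 ≤ nf → nf + j ≤ nScales β + 1 → (4 : ℝ) ^ (m + 2) * U ≤ (4 : ℝ) ^ (2 * nf + dd) →
        ∀ Λw : ℝ, 0 ≤ Λw → Λw ≤ klScale klE0 (nf + j) →
        ∀ (X : SpaceTimeIdx L M × SectorLeg (sectorCount nf)) (t : ImagTimeIdx M) (ℓ : SectorLeg (sectorCount nf)),
          ∑ y : TorusSite 2 L, ‖((sectorSubMatrix L M β (bgmFatMultiplier L M klE0 β (nambuXiCT L μ (klFlowFrameU L M β U μ m)) nf)).transpose *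
            klSliceCov L M β μ (klFlowFrameU L M β U μ m) (nf + j) *
            sectorSubMatrix L M β (bgmFatMultiplier L M klE0 β (nambuXiCT L μ (klFlowFrameU L M β U μ m)) nf)) X ((t, y), ℓ)‖ *
              (1 + Λw * (Torus.tnorm (X.1.2 - y) : ℝ)) ≤ Ce := by
  obtain ⟨Ce, hCe, h⟩ := secWt_klSliceCov_bgmFat_klEng_flow_deep j dd
  refine ⟨Ce, hCe, ?_⟩
  intro G P R Q cc hR2 hcc hcc6 μ hμ U hU hUle β hβmin hβc L M _ _ hL3 hM3 n hnN hhist m hm1 hmn nf hnf hnfN hwin Λw hΛw0 hΛwle X t ℓ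
  exact h G P R Q cc hR2 hcc hcc6 μ hμ U hU hUle β hβmin hβc L M hL3 hM3 m hm1 (hmn.trans hnN) (histP_klPredsV17F2_restrict hmn hhist)
    (frameOK_klFlowFrameU_of_histP_le hR2 hm1 hmn (hmn.trans hnN) hhist) nf hnf hnfN hwin Λw hΛw0 hΛwle X t ℓ

/-- **M3b-j (ii) BY NAME**: the sectional datum BUNDLED as `TwoVolumeDefect.ScaleCovSecData (S(F̃_nf)ᵀ·klSliceCov (nf+j)·S(F̃_nf)) Λ_w Ce` at the flow
frame `K_n`, deep window, every rate `0 ≤ Λ_w ≤ Λ_{nf+j}` (same binders and constant as `secWt_klSliceCov_bgmFat_klEng_flow_deep`).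
[cite: BenfattoGiulianiMastropietro2006, §2.8 (2.81), §3 (3.3)] -/
theorem scaleCovSecData_klSliceCov_bgmFat_klEng_flow_deep (j dd : ℕ) :
    ∃ Ce : ℝ, 0 < Ce ∧
      ∀ (G : GeoConsts) (P : SplitConsts) (R : RenConsts) (Q : EngConsts) (cc : ℝ), R.WF2 → 0 < cc → cc ≤ EngineV8.klEngC₃6 P R →
      ∀ μ ∈ klWindowC, ∀ U : ℝ, 0 < U → U ≤ min (EngineV8.klEngU₀3 P R cc) (1 / (R.Gfr 3 + 1)) →
      ∀ β : ℝ, klBetaMin ≤ β → β ≤ Real.exp (cc / U ^ 2) →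
      ∀ (L M : ℕ) [NeZero L] [NeZero M], EngineV8.klEngL₃ β U ≤ L → EngineV8.klEngM₃ β U L ≤ M →
      ∀ n : ℕ, 1 ≤ n → n ≤ nScales β + 1 →
        HistP klPredsV17F2 L M G P Q R β U μ 0 n → FrameOK R U (nScales β) μ (klFlowFrameU L M β U μ n) →
        ∀ nf : ℕ, 1 ≤ nf → nf + j ≤ nScales β + 1 → (4 : ℝ) ^ (n + 2) * U ≤ (4 : ℝ) ^ (2 * nf + dd) →
        ∀ Λw : ℝ, 0 ≤ Λw → Λw ≤ klScale klE0 (nf + j) →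
          TwoVolumeDefect.ScaleCovSecData
            ((sectorSubMatrix L M β (bgmFatMultiplier L M klE0 β (nambuXiCT L μ (klFlowFrameU L M β U μ n)) nf)).transpose *
              klSliceCov L M β μ (klFlowFrameU L M β U μ n) (nf + j) *
              sectorSubMatrix L M β (bgmFatMultiplier L M klE0 β (nambuXiCT L μ (klFlowFrameU L M β U μ n)) nf)) Λw Ce := by
  obtain ⟨Ce, hCe, h⟩ := secWt_klSliceCov_bgmFat_klEng_flow_deep j dd
  refine ⟨Ce, hCe, ?_⟩
  intro G P R Q cc hR2 hcc hcc6 μ hμ U hU hUle β hβmin hβc L M _ _ hL3 hM3 n hn1 hnN hhist hfr nf hnf hnfN hwin Λw hΛw0 hΛwle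
  exact ⟨h G P R Q cc hR2 hcc hcc6 μ hμ U hU hUle β hβmin hβc L M hL3 hM3 n hn1 hnN hhist hfr nf hnf hnfN hwin Λw hΛw0 hΛwle⟩

end Summit.HubbardSuperconductivity.HubbardSuperconductivity.Theorems.TorusFourierL2

end
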